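import Summits.BirchSwinnertonDyer.BirchSwinnertonDyer.Theorems.PrintX11aMultOrbitKernel
import Summits.BirchSwinnertonDyer.BirchSwinnertonDyer.Theorems.PrintX11aMultAtkinLehnerPeriods
import Summits.BirchSwinnertonDyer.BirchSwinnertonDyer.Theorems.PrintX11aMultThreeWinding
import Summits.BirchSwinnertonDyer.BirchSwinnertonDyer.Theorems.PrintX8VerticalStevensIrreducible
import Literature.NumberTheory.EllipticCurves.PlusSymbolBoundOddMultiplicativeProofs
import Literature.NumberTheory.EllipticCurves.AtkinLehnerInvolutionsProofs
import Literature.NumberTheory.EllipticCurves.PAdicLFunctionInterpolationProofs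
import HarnessLib

/-!
# Crux `X11aLowerHalf` (item stmt-BirchSwinnertonDyer-19064), stub `stub_muAnDeepFive` side — THE WINDING THEOREM AT A
# MULTIPLICATIVE ODD PRIME `p`: a unit plus symbol `[u/pᵏ]⁺_f` exists

Cell `bsd-print-x11a`, width seat bsd-line-x11a-p1-w2 g3 (`--supports stmt-BirchSwinnertonDyer-19064`). Theorems only; no
definition, no named fact, no `sorry`. BSD is not proved by any of this; nothing is asserted about any specific curve.

**`exists_one_le_norm_ratPlusSymbol_div_prime_pow`.** For every elliptic curve `E = W/ℚ` (globally minimal model) with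
MULTIPLICATIVE reduction at an ODD prime `p` and `E[p]` IRREDUCIBLE, and every newform `f` of `W` (level `N = pM`, `p ∤ M`):
some plus symbol `[u/pᵏ]⁺_f` with `k ≥ 1`, `p ∤ u` — a value (up to the sign `a_pᵏ`) of the Mazur–Tate–Teitelbaum measure
`μ_E` on `ℤ_pˣ` (MTT §I.10 with `ε(p) = 0`: `μ(a + pᵏℤ_p) = a_p^{-k}[a/pᵏ]⁺`) — has `p`-adic norm `≥ 1`.  Equivalently: the
EVEN measure `μ_E⁺` is not divisible by `p`, i.e. SOME even tame branch `L_p(E, ω^{2i})` has `μ`-invariant `0`.  This is the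
p-GENERIC form of bsd-line-x11a-p2 g2's `MultThreeWinding.exists_one_le_norm_ratPlusSymbol_div_three_pow` (there `p = 3`, where
the only even branch is `ω⁰` and the statement IS Greenberg's analytic `μ₃ = 0`); the proof is the same word for word with
`3 ↦ p`: the ATKIN–LEHNER-EXTENDED ORBIT TRICK in `GL₂(ℤ[1/p])` (`MultOrbit.mem_of_orbitTrick`, files
`…MultOrbit{Defs,Decomposition,Kernel}`) fed by the period relations of `…MultAtkinLehnerPeriods`:
* the period datum: `m γ := [γ·0]⁺_f − [0]⁺_f = re{∞, γ∞}_f/Ω⁺_f` (Manin), `σ := −a_p(f)` (the `w_p`-eigenvalue, tree theorem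
  `IsNewform0.atkinLehnerInvolution_eq_smul_of_not_dvd`), `γ₀ = W²/p`, `κ := m γ₀ / 2`, `Z := {q : ‖q‖_p < 1}`;
  `W`-equivariance `m(γ^W) = σ m(γ)` and `m γ₀ = (1 + σ)([y/p]⁺ − [0]⁺)` are (i)/(ii) of the sibling file;
* the three local hypotheses of the kernel theorem follow from the NEGATION of the goal («every `[u/pᵏ]⁺`, `k ≥ 1`, `p ∤ u`, is a
  non-unit») together with `2[0]⁺ = −Σ_{j=1}^{p−1} [j/p]⁺` at non-split `p` (the `U_p`-relation `intCast_mul_ratPlusSymbol_of_dvd`;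
  `‖2‖_p = 1` as `p` is odd) and the evenness/periodicity of `[·]⁺`;
* hence `p ∣ m` on `Γ₁(N)` — impossible by the Hecke bridge `exists_mem_one_le_norm_sub_of_spanModBy_of_prime` at a good prime
  `ℓ` with `a_ℓ(E) ≢ ℓ + 1 (mod p)` (`E[p]` irreducible: `not_irreducible_of_frobeniusTrace_congr_holds`).
HONEST SCOPE: for `p ≥ 5` this is NOT `μ(L_p(E, ω⁰)) = 0` (= `X11a.MuAnZeroAt`, the registered stub): the `ω⁰` branch sees only
the push-forward of `μ_E` to `1 + pℤ_p` (Teichmüller orbit SUMS), and the orbit trick controls single symbols.  beyond-print: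
yes — Greenberg's Conj. 1.11 (analytic side) on SOME even branch at a multiplicative prime for residually irreducible `E`, and the
multiplicative-level orbit trick, are not in print.
References: [Manin1972] Prop. 1.4, Thm. 1.6; [MazurTateTeitelbaum1986Invent] §I.4 (4.2), §I.8, §I.10, §I.17;
[Vaserstein1972SL2] Theorem; [Knapp1993] Lemma 9.24, Thm. 9.27; [GreenbergLNM1716] Conj. 1.11.
-/

set_option linter.dupNamespace false
set_option autoImplicit false

namespace Summit.BirchSwinnertonDyer.BirchSwinnertonDyer.Theorems.MultWinding

open scoped MatrixGroups ModularForm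
open CongruenceSubgroup Matrix.SpecialLinearGroup WeierstrassCurve
  Literature.NumberTheory.EllipticCurves Literature.NumberTheory.EllipticCurves.ModularForms
  Literature.NumberTheory.EllipticCurves.Rank1Residual
  Summit.BirchSwinnertonDyer.BirchSwinnertonDyer.Theorems.MultOrbit
  Summit.BirchSwinnertonDyer.BirchSwinnertonDyer.Theorems.MultAL
  Summit.BirchSwinnertonDyer.BirchSwinnertonDyer.Theorems.MultThreeWinding

open Summit.BirchSwinnertonDyer.BirchSwinnertonDyer.Theorems.MultThreeOrbit (mem_Gamma0_of_dvd dvd_of_mem_Gamma0)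

noncomputable section

variable {N : ℕ} [NeZero N] {f : CuspForm (Gamma0 N) 2}

/-- **THE WINDING THEOREM AT A MULTIPLICATIVE ODD PRIME.** For an elliptic curve `E = W/ℚ` (globally minimal model) with
MULTIPLICATIVE reduction at an odd prime `p` and `E[p]` IRREDUCIBLE, and every newform `f` of `W`: SOME plus symbol
`[u/pᵏ]⁺_f` (`k ≥ 1`, `p ∤ u`) — a value of the Mazur–Tate–Teitelbaum measure on `ℤ_pˣ` — is a `p`-adic unit
(norm `≥ 1`).  Proof: if all were non-units, the period datum `m γ = [γ0]⁺ − [0]⁺`, `σ = −a_p`, `Z = {‖·‖_p < 1}`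
satisfies the hypotheses of the kernel theorem `MultOrbit.mem_of_orbitTrick` (Atkin–Lehner-extended orbit trick in
`GL₂(ℤ[1/p])`: (i)/(ii) of `…MultAtkinLehnerPeriods`, `2[0]⁺ = −Σ_{0<j<p} [j/p]⁺` at non-split `p` by the
`U_p`-relation), so `p ∣ m` on `Γ₁(N)`, contradicting the Hecke bridge `exists_mem_one_le_norm_sub_of_spanModBy_of_prime`
at a good prime `ℓ` with `a_ℓ ≢ ℓ + 1 (mod p)` (which exists since `E[p]` is irreducible).  No named fact is used.
[cite: Manin1972, Prop. 1.4, Thm. 1.6] [cite: MazurTateTeitelbaum1986Invent, §I.4 (4.2), §I.10]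
[cite: Vaserstein1972SL2, Theorem, p. 313] [cite: Knapp1993, Lemma 9.24, Thm. 9.27] -/
theorem exists_one_le_norm_ratPlusSymbol_div_prime_pow
    (W : WeierstrassCurve ℚ) [W.IsElliptic] [W.IsGloballyMinimal] (p : ℕ) [Fact p.Prime] (hp2 : p ≠ 2)
    (hmult : W.HasMultiplicativeReductionAtPrime p) (hirr : W.HasIrreducibleModPGaloisRep p)
    (hf : IsNewformOf W f) :
    ∃ (k : ℕ) (u : ℤ), 1 ≤ k ∧ ¬ (p : ℤ) ∣ u ∧
      1 ≤ ‖((ratPlusSymbol f ((u : ℚ) / (p : ℚ) ^ k) : ℚ) : ℚ_[p])‖ := by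
  have hp : p.Prime := Fact.out
  haveI hp0 : NeZero p := ⟨hp.ne_zero⟩
  have hpprime : Prime (p : ℤ) := Nat.prime_iff_prime_int.mp hp
  -- ultrametric bookkeeping: finite sums of small elements are small; `‖2‖_p = 1` (`p` odd)
  have norm_sum_lt_one : ∀ {ι : Type} (s : Finset ι) (g : ι → ℚ_[p]),
      (∀ i ∈ s, ‖g i‖ < 1) → ‖∑ i ∈ s, g i‖ < 1 := fun s g h ↦
    Finset.sum_induction g (fun x => ‖x‖ < 1)
      (fun a b ha hb => lt_of_le_of_lt (Padic.nonarchimedean a b) (max_lt ha hb)) (by simp) h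
  have norm_two_eq_one : ‖(2 : ℚ_[p])‖ = 1 := by
    have h2 : (2 : ℚ_[p]) = ((2 : ℤ) : ℚ_[p]) := by norm_cast
    rw [h2]
    refine le_antisymm (Padic.norm_int_le_one 2) (not_lt.mp fun hlt ↦ ?_)
    rw [Padic.norm_intCast_lt_one_iff] at hlt
    have h2' : (p : ℤ) ∣ ((2 : ℕ) : ℤ) := by simpa using hlt
    have : p ∣ 2 := by exact_mod_cast h2'
    exact hp2 ((Nat.prime_dvd_prime_iff_eq hp Nat.prime_two).mp this)
  by_contra H
  push Not at H
  -- H : ∀ k u, 1 ≤ k → ¬ p ∣ u → ‖[u/p^k]⁺‖ < 1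
  -- ### rationality / reality of the symbols
  have hQ : coeffField f = ⊥ := hf.coeffField_eq_bot
  have hrat : ∀ r : ℚ, (ratPlusSymbol f r : ℝ) = normalizedPlusSymbol f r :=
    fun r ↦ ratCast_ratPlusSymbol_holds hf.1 hQ r
  have hreal : ∀ n, (cuspCoeff f n).im = 0 := cuspCoeff_im_eq_zero_of_coeffField_eq_bot hQ
  -- ### the level `N = pM`, `p ∤ M`, and `a_p = ±1`
  obtain ⟨hpN, hp2N, ap, hap, hap'⟩ := hf.dvd_level_and_not_sq_dvd_of_multiplicative hmult
  set M : ℕ := N / p with hMdef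
  have hNM : N = p * M := (Nat.mul_div_cancel' hpN).symm
  have hpM : ¬ p ∣ M := by
    rintro ⟨t, ht⟩
    exact hp2N ⟨t, by rw [hNM, ht]; ring⟩
  have hM : 0 < M := Nat.pos_of_ne_zero (by rintro h0; exact NeZero.ne N (by simp [hNM, h0]))
  have hc : Nat.Coprime p (N / p) := (Nat.Prime.coprime_iff_not_dvd hp).mpr hpM
  -- ### the Atkin–Lehner data: `W = (px, y; pM, p)`, `px − My = 1`, `ε = −a_p`
  set x : ℤ := (atkinLehnerSL N p : SL(2, ℤ)) 0 0 with hx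
  set y : ℤ := (atkinLehnerSL N p : SL(2, ℤ)) 0 1 with hy
  have hbez : (p : ℤ) * x - (M : ℤ) * y = 1 := by
    have := atkinLehnerSL_bezout N p hc
    rw [hx, hy]; exact_mod_cast this
  set σ : ℤ := -ap with hσdef
  have hσ : σ = 1 ∨ σ = -1 := by rcases hap' with h | h <;> simp [hσdef, h]
  set ε : ℂ := (σ : ℂ) with hεdef
  have hε1 : ε ^ 2 = 1 := by rcases hσ with h | h <;> simp [hεdef, h]
  have hε : atkinLehnerInvolution N 2 p f = ε • f := by
    have h := IsNewform0.atkinLehnerInvolution_eq_smul_of_not_dvd (N := N) (k := 2) (p := p) hNM hpM hf.1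
    rw [h]
    congr 1
    have h1 : ((p : ℝ) ^ (1 - ((2 : ℤ) : ℝ) / 2) : ℝ) = 1 := by
      rw [show (1 - ((2 : ℤ) : ℝ) / 2 : ℝ) = 0 by norm_num, Real.rpow_zero]
    have h2 : (PowerSeries.coeff p) (UpperHalfPlane.qExpansion 1 ⇑f) = (ap : ℂ) := hap
    simp only [h1, h2, hεdef, hσdef]; push_cast; ring
  -- ### the period datum `m`, the subgroup `Z`
  set m : Gamma0 N → ℚ := fun γ ↦
    ratPlusSymbol f ((((γ : SL(2, ℤ)) 0 1 : ℤ) : ℚ) / (((γ : SL(2, ℤ)) 1 1 : ℤ) : ℚ)) - ratPlusSymbol f 0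
    with hmdef
  let Z : AddSubgroup ℚ :=
    { carrier := {q | ‖((q : ℚ) : ℚ_[p])‖ < 1}
      add_mem' := by
        intro a b ha hb
        simp only [Set.mem_setOf_eq] at ha hb ⊢
        push_cast
        exact lt_of_le_of_lt (Padic.nonarchimedean _ _) (max_lt ha hb)
      zero_mem' := by simp
      neg_mem' := by
        intro a ha
        simp only [Set.mem_setOf_eq] at ha ⊢
        push_cast; rwa [norm_neg] }
  have hZ : ∀ q : ℚ, q ∈ Z ↔ ‖((q : ℚ) : ℚ_[p])‖ < 1 := fun q ↦ Iff.rfl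
  have hd0 : ∀ γ : Gamma0 N, ((γ : SL(2, ℤ)) 1 1 : ℤ) ≠ 0 := fun γ h ↦
    not_p_dvd_d hp hNM γ (by rw [h]; exact dvd_zero _)
  have hm_cast : ∀ γ : Gamma0 N, (m γ : ℝ) = (cuspSymbol f γ).re / plusPeriod f :=
    fun γ ↦ ratCast_periodValue_eq hrat hreal γ (hd0 γ)
  have hm_mul : ∀ γ γ' : Gamma0 N, m (γ * γ') = m γ + m γ' := by
    intro γ γ'
    have : ((m (γ * γ') : ℚ) : ℝ) = ((m γ + m γ' : ℚ) : ℝ) := by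
      push_cast
      rw [hm_cast, hm_cast, hm_cast, cuspSymbol_mul_holds f, Complex.add_re, add_div]
    exact_mod_cast this
  have hm_conj : ∀ γ γ' : Gamma0 N, ((γ' : SL(2, ℤ)) : Matrix (Fin 2) (Fin 2) ℤ) * Wint p M x y =
      Wint p M x y * ((γ : SL(2, ℤ)) : Matrix (Fin 2) (Fin 2) ℤ) → m γ' = σ * m γ := by
    intro γ γ' hconj
    have h := cuspSymbol_eq_mul_of_conj_alWInt hpN hc hε γ γ' hconj
    have : ((m γ' : ℚ) : ℝ) = ((σ * m γ : ℚ) : ℝ) := by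
      push_cast
      rw [hm_cast, hm_cast, h, hεdef]
      simp [Complex.mul_re]
      ring
    exact_mod_cast this
  obtain ⟨γ₀, hsq⟩ := exists_sq_alWInt (N := N) hpN hc
  have hii := cuspSymbol_eq_of_sq_alWInt hpN hc hε hε1 γ₀ hsq
  -- `m γ₀ = (1 + σ)([y/p]⁺ − [0]⁺)`
  have hmγ₀ : m γ₀ = (1 + σ) * (ratPlusSymbol f ((y : ℚ) / p) - ratPlusSymbol f 0) := by
    have : ((m γ₀ : ℚ) : ℝ) = (((1 + σ) * (ratPlusSymbol f ((y : ℚ) / p) - ratPlusSymbol f 0) : ℚ) : ℝ) := by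
      push_cast
      rw [hm_cast, hii, ratCast_ratPlusSymbol_eq_re_div hrat hreal, ratCast_ratPlusSymbol_eq_re_div hrat hreal,
        hεdef]
      have : (((y : ℚ) / p : ℚ)) = (((atkinLehnerSL N p : SL(2, ℤ)) 0 1 : ℚ) / (p : ℚ)) := by rw [hy]
      rw [this]
      simp [Complex.mul_re, Complex.sub_re]
      ring
    exact_mod_cast this
  set κ : ℚ := m γ₀ / 2 with hκdef
  have hκ : (1 + σ) * κ = m γ₀ := by
    rcases hσ with h | h
    · rw [hκdef, h]; ring
    · rw [hκdef, hmγ₀, h]; ring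
  have hconjex : ∀ γ : Gamma0 N, ∃ γ' : Gamma0 N,
      ((γ' : SL(2, ℤ)) : Matrix (Fin 2) (Fin 2) ℤ) * Wint p M x y =
        Wint p M x y * ((γ : SL(2, ℤ)) : Matrix (Fin 2) (Fin 2) ℤ) :=
    fun γ ↦ exists_conj_alWInt (N := N) hpN hc γ
  -- ### the three local smallness hypotheses
  have hpy : ¬ (p : ℤ) ∣ y := not_p_dvd_y hbez hp
  have h_b0 : ∀ γ : Gamma0 N, (γ : SL(2, ℤ)) 0 1 = 0 → m γ ∈ Z := by
    intro γ hb
    rw [hZ]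
    have : m γ = 0 := by simp only [hmdef, hb, Int.cast_zero, zero_div, sub_self]
    rw [this]; simp
  have hper : ∀ (r : ℚ) (n : ℤ), ratPlusSymbol f (r + n) = ratPlusSymbol f r :=
    fun r n ↦ ratPlusSymbol_add_intCast_holds (f := f) r n
  have h_d1 : ∀ γ : Gamma0 N, ((γ : SL(2, ℤ)) 1 1 = 1 ∨ (γ : SL(2, ℤ)) 1 1 = -1) → m γ ∈ Z := by
    intro γ hd
    rw [hZ]
    have : m γ = 0 := by
      rcases hd with h | h
      · simp only [hmdef, h, Int.cast_one, div_one]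
        rw [← zero_add ((((γ : SL(2, ℤ)) 0 1 : ℤ) : ℚ)), hper, sub_self]
      · simp only [hmdef, h, Int.cast_neg, Int.cast_one, div_neg, div_one]
        rw [← Int.cast_neg, ← zero_add (((-((γ : SL(2, ℤ)) 0 1) : ℤ) : ℚ)), hper, sub_self]
    rw [this]; simp
  -- `[0]⁺` is small when `σ = 1` (non-split: `a_p = −1`, the `U_p`-relation gives `2[0]⁺ = −Σ_{0<j<p} [j/p]⁺`)
  have h0small : σ = 1 → ‖((ratPlusSymbol f 0 : ℚ) : ℚ_[p])‖ < 1 := by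
    intro hσ1
    have hapm : ap = -1 := by rw [hσdef] at hσ1; omega
    have hU := intCast_mul_ratPlusSymbol_of_dvd p hf.1 hp hpN hap hrat 0
    rw [hapm] at hU
    set j0 : Fin p := ⟨0, hp.pos⟩ with hj0
    rw [← Finset.add_sum_erase _ _ (Finset.mem_univ j0)] at hU
    have hj0v : ((j0 : ℕ) : ℚ) = 0 := by simp [hj0]
    have hterm0 : ratPlusSymbol f ((0 + ((j0 : ℕ) : ℚ)) / p) = ratPlusSymbol f 0 := by
      rw [hj0v, add_zero, zero_div]
    have hsum : ‖((∑ j ∈ Finset.univ.erase j0, ratPlusSymbol f ((0 + ((j : ℕ) : ℚ)) / p) : ℚ) : ℚ_[p])‖ < 1 := by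
      push_cast
      refine norm_sum_lt_one _ _ fun j hj ↦ ?_
      have hj0' : (j : ℕ) ≠ 0 := by
        intro h
        exact (Finset.mem_erase.mp hj).1 (Fin.ext (by rw [hj0]; exact h))
      have hjp : ¬ (p : ℤ) ∣ ((j : ℕ) : ℤ) := by
        intro h
        have h1 : p ∣ (j : ℕ) := by exact_mod_cast h
        have h2 := Nat.le_of_dvd (Nat.pos_of_ne_zero hj0') h1
        exact absurd j.isLt (not_lt.mpr h2)
      have := H 1 ((j : ℕ) : ℤ) le_rfl hjp
      simpa using this
    have h2eq : (2 : ℚ) * ratPlusSymbol f 0 =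
        -∑ j ∈ Finset.univ.erase j0, ratPlusSymbol f ((0 + ((j : ℕ) : ℚ)) / p) := by
      rw [hterm0] at hU
      push_cast at hU
      linear_combination -hU
    have h2n : ‖(((2 : ℚ) * ratPlusSymbol f 0 : ℚ) : ℚ_[p])‖ < 1 := by
      rw [h2eq]; push_cast; rw [norm_neg]
      push_cast at hsum
      exact hsum
    push_cast at h2n
    rw [norm_mul, norm_two_eq_one, one_mul] at h2n
    exact h2n
  have hysmall : ‖((ratPlusSymbol f ((y : ℚ) / p) : ℚ) : ℚ_[p])‖ < 1 := by
    have := H 1 y le_rfl hpy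
    simpa using this
  have h_W : ∀ γ : Gamma0 N,
      (∃ e : ℕ, 1 ≤ e ∧ ((γ : SL(2, ℤ)) 1 0 * y + (γ : SL(2, ℤ)) 1 1 * (p : ℤ) : ℤ).natAbs = p ^ e) →
        m γ + κ ∈ Z := by
    rintro γ ⟨e, he1, he⟩
    set a : ℤ := (γ : SL(2, ℤ)) 0 0 with ha
    set b : ℤ := (γ : SL(2, ℤ)) 0 1 with hb
    set c : ℤ := (γ : SL(2, ℤ)) 1 0 with hcc
    set d : ℤ := (γ : SL(2, ℤ)) 1 1 with hdd
    have hD0 : (c * y + d * (p : ℤ) : ℤ) ≠ 0 := by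
      intro h0; rw [h0, Int.natAbs_zero] at he; exact (pow_ne_zero e hp.ne_zero) he.symm
    -- `m γ = [γ(y/p)]⁺ − [y/p]⁺`
    have hr : (c : ℚ) * ((y : ℚ) / p) + (d : ℚ) ≠ 0 := by
      intro h0
      apply hD0
      have hp0 : (p : ℚ) ≠ 0 := by exact_mod_cast hp.ne_zero
      have : ((c * y + d * (p : ℤ) : ℤ) : ℚ) = p * ((c : ℚ) * ((y : ℚ) / p) + (d : ℚ)) := by
        push_cast; field_simp
      exact_mod_cast (show ((c * y + d * (p : ℤ) : ℤ) : ℚ) = 0 by rw [this, h0, mul_zero])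
    have hmγ : m γ = ratPlusSymbol f (((a : ℚ) * ((y : ℚ) / p) + (b : ℚ)) / ((c : ℚ) * ((y : ℚ) / p) + (d : ℚ))) -
        ratPlusSymbol f ((y : ℚ) / p) := periodValue_eq_sub hrat hreal γ (hd0 γ) _ hr
    -- the cusp `γ(y/p) = u/pᵉ` with `p ∤ u`
    have hpc : (p : ℤ) ∣ c := dvd_trans ⟨(M : ℤ), by rw [hNM]; push_cast; ring⟩ (dvd_of_mem_Gamma0 γ.2)
    have hpnum : ¬ (p : ℤ) ∣ a * y + b * (p : ℤ) := by
      intro h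
      have hpa : (p : ℤ) ∣ a := by
        have : (p : ℤ) ∣ a * y := by simpa using dvd_sub h (dvd_mul_left (p : ℤ) b)
        exact (hpprime.dvd_or_dvd this).resolve_right hpy
      have hdet := Matrix.SpecialLinearGroup.det_coe (γ : SL(2, ℤ))
      rw [Matrix.det_fin_two] at hdet
      exact MultOrbit.not_intCast_dvd_one hp (by
        rw [← hdet]; exact dvd_sub (dvd_mul_of_dvd_left hpa _) (dvd_mul_of_dvd_right hpc _))
    obtain ⟨u, hup, hval⟩ : ∃ u : ℤ, ¬ (p : ℤ) ∣ u ∧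
        ((a : ℚ) * ((y : ℚ) / p) + (b : ℚ)) / ((c : ℚ) * ((y : ℚ) / p) + (d : ℚ)) = (u : ℚ) / (p : ℚ) ^ e := by
      have hp0 : (p : ℚ) ≠ 0 := by exact_mod_cast hp.ne_zero
      have hq : ((a : ℚ) * ((y : ℚ) / p) + (b : ℚ)) / ((c : ℚ) * ((y : ℚ) / p) + (d : ℚ)) =
          ((a * y + b * (p : ℤ) : ℤ) : ℚ) / ((c * y + d * (p : ℤ) : ℤ) : ℚ) := by
        have hD0' : ((c * y + d * (p : ℤ) : ℤ) : ℚ) ≠ 0 := by exact_mod_cast hD0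
        rw [div_eq_div_iff hr hD0']; push_cast; field_simp
      rcases Int.natAbs_eq (c * y + d * (p : ℤ)) with hs | hs <;> rw [he] at hs
      · refine ⟨a * y + b * (p : ℤ), hpnum, ?_⟩
        rw [hq, hs]; push_cast; ring
      · refine ⟨-(a * y + b * (p : ℤ)), by rwa [dvd_neg], ?_⟩
        rw [hq, hs]; push_cast; ring
    rw [hmγ, hval, hZ]
    rcases hσ with hσ1 | hσm
    · -- `σ = 1`: `κ = [y/p]⁺ − [0]⁺`, value `[u/pᵉ]⁺ − [0]⁺`
      have hκ1 : κ = ratPlusSymbol f ((y : ℚ) / p) - ratPlusSymbol f 0 := by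
        rw [hκdef, hmγ₀, hσ1]; ring
      rw [hκ1, show ratPlusSymbol f ((u : ℚ) / (p : ℚ) ^ e) - ratPlusSymbol f ((y : ℚ) / p) +
        (ratPlusSymbol f ((y : ℚ) / p) - ratPlusSymbol f 0) =
          ratPlusSymbol f ((u : ℚ) / (p : ℚ) ^ e) - ratPlusSymbol f 0 by ring]
      push_cast
      rw [sub_eq_add_neg]
      refine lt_of_le_of_lt (Padic.nonarchimedean _ _) (max_lt (H e u he1 hup) ?_)
      rw [norm_neg]; exact h0small hσ1
    · -- `σ = −1`: `κ = 0`, value `[u/pᵉ]⁺ − [y/p]⁺`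
      have hκ0 : κ = 0 := by rw [hκdef, hmγ₀, hσm]; ring
      rw [hκ0, add_zero]
      push_cast
      rw [sub_eq_add_neg]
      refine lt_of_le_of_lt (Padic.nonarchimedean _ _) (max_lt (H e u he1 hup) ?_)
      rw [norm_neg]; exact hysmall
  -- ### the kernel theorem on `Γ₁(N)`
  have hkernel : ∀ γ : Gamma0 N, γ ∈ Gamma1' N → m γ ∈ Z := by
    intro γ hγ1
    have hγM : (γ : SL(2, ℤ)) ∈ Gamma0 M :=
      mem_Gamma0_of_dvd (dvd_trans ⟨(p : ℤ), by rw [hNM]; push_cast; ring⟩ (dvd_of_mem_Gamma0 γ.2))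
    have hd1 : ((((γ : SL(2, ℤ)) 1 1 : ℤ)) : ZMod M) = 1 := by
      have h1 : ((((γ : SL(2, ℤ)) 1 1 : ℤ)) : ZMod N) = 1 := Gamma1_mem'.mp hγ1
      have hMN : M ∣ N := ⟨p, by rw [hNM]; ring⟩
      have := congrArg (ZMod.castHom hMN (ZMod M)) h1
      rwa [map_intCast, map_one] at this
    exact mem_of_orbitTrick hbez hp hNM hpM hM Z m σ κ γ₀ hσ hm_mul hm_conj hsq hκ hconjex h_b0 h_d1 h_W γ
      ⟨(γ : SL(2, ℤ)), hγM⟩ rfl ⟨0, Or.inl (by simpa [dEntry] using hd1)⟩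
  -- ### the Hecke bridge at a good prime `ℓ` with `a_ℓ ≢ ℓ + 1 (mod p)`
  obtain ⟨ℓ, hℓinst, -, hgoodℓ, hℓ1⟩ :=
    exists_prime_not_dvd_frobeniusTrace_sub not_irreducible_of_frobeniusTrace_congr_holds W p hirr
  haveI := hℓinst
  have hℓN : ¬ ℓ ∣ N := not_dvd_level_of_isNewformOf hf hgoodℓ
  set S : Set (Gamma0 N) := {γ | ‖((ratPlusSymbol f ((((γ : SL(2, ℤ)) 0 1 : ℤ) : ℚ) /
    (((γ : SL(2, ℤ)) 1 1 : ℤ) : ℚ)) - ratPlusSymbol f 0 : ℚ) : ℚ_[p])‖ < 1} with hSdef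
  have hS : SpanModBy N p S := fun γ hγ ↦
    Subgroup.mem_sup_left (Subgroup.subset_closure (Or.inl (Or.inl (hkernel γ hγ))))
  obtain ⟨γ, hγS, hge⟩ := PrintX8VerticalStevens.exists_mem_one_le_norm_sub_of_spanModBy_of_prime hf.1 hQ
    (p := p) hp2 hℓN (cuspCoeff_eq_frobeniusTrace_of_isNewformOf_holds hf hgoodℓ) hℓ1 S hS
  exact absurd hge (not_le.mpr hγS)

end

end Summit.BirchSwinnertonDyer.BirchSwinnertonDyer.Theorems.MultWinding
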